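import Summits.QuantumFields.YangMills.Theses.LuscherReduction
import Summits.QuantumFields.YangMills.Theorems.LuscherReductionTwistedTraceScalingTowerOfUniform
import Summits.QuantumFields.YangMills.Theorems.LuscherReductionTwistedTraceScalingOneSiteTraceLimit
import Summits.QuantumFields.YangMills.Theorems.LuscherReductionTwistedTraceScalingTowerTargets
import HarnessLib

/-!
# S-TOWER with E1 COVERAGE (owner ruling GENERAL-L-COVERAGE R2/R3): the block-spin-shaped step-scaling stub `TOWER-E1` — pairs
# `(L, b)` with `b ∈ [M, M²)` the base of ONE irregular first layer + regular `M`-adic layers — composes with S-BASE to the crux (kernel-checked)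

Route `LuscherReduction` (owner ym-beyond-p1), crux `TwistedTraceScaling` (stmt-QuantumFields-20203), line «twolattice» (sha16 a5c3dbcbf75f28d1), lead
ym-lead-20203-twolattice g0.  The registered S-TOWER compares ALL pairs `L ≥ L₁ ≥ L0` at matched label.  A block-spin RG (strategy A) relates a fine
lattice `L` only to lattices it can be blocked onto; by the owner's ruling (20203 evidence #20/#21, `CoverageSketch.lean` 8e70bcfb3fd72b70) the honest
reach with ONE irregular first layer (block sides `M`/`M+1`) followed by regular `M`-blockings is: every `L ≥ M²` lands on a base `b ∈ [M, M²)` with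
`b·M^{k+1} ≤ L < b·M^k·(M+1)` (`exists_tower_landing`, ported here from the owner's sketch).  This file types the correspondingly SHAPED stub text

  `TOWER-E1 := ∀ s>0 ε>0, ∃ M ≥ 2, ∃ lam0>0, ∀ lam ∈ (0,lam0], ∀ L ≥ M², ∀ β ∈ W(lam,L), ∀ b k [NeZero b], M ≤ b → b < M² → b·M^{k+1} ≤ L → L < b·M^k·(M+1) →
              ∀ β₁ ≥ 1, 1/ḡ²(β₁,b) = 1/ḡ²(β,L) → |traceRatio L β (femtoSteps s β L) − traceRatio b β₁ (femtoSteps s β₁ b)| ≤ ε`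

(spelled out as a hypothesis; no definitions) and proves:

* §1 `exists_tower_landing` (owner g24, ported verbatim) — the E1 arithmetic.
* §2 ★ `twistedTraceScaling_of_towerE1_of_base : TOWER-E1 → ⟨S-BASE body⟩ → TwistedTraceScaling` — the crux BY NAME from the E1-shaped tower and the
  fixed-lattice law on the FINITE base range `[M, M²)` (finite max of S-BASE thresholds; matched coarse coupling by `Tower.exists_matched`, large by
  `Tower.matched_ge`; one-site side by the closed S-OSTL `TraceDoor.oneSiteTraceLimit`, `|T·λ_b(B) − s| ≤ λ_b(B)` from `Base.femtoSteps_mul_unit` and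
  `bareLambda_oneSiteCoupling`).  Imports are route-file + cone-free helper modules only.
* §3 `towerE1_of_tower : ⟨S-TOWER body⟩ → TOWER-E1` — the reshaped text is WEAKER than the registered one (honesty of R2: a line proving only E1-reachable
  pairs must say so; this is the text that says so and still closes the crux).
* §4 ★ `towerE1_of_logRatioMatchE1` / `twistedTraceScaling_of_logRatioMatchE1_of_base` — the same in the RG-native currency: `LogRatioMatch` RESTRICTED to
  E1-reachable pairs (the owner's located A3 target) implies TOWER-E1 (1-Lipschitz on `(0,1]`, `Tower.traceRatio_mem`), hence with S-BASE the crux.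

Offered to the owner as the strategy-A reshape of S-TOWER («your pen»: the registry is the owner's; nothing is registered here).  HONEST FRAMING: bookkeeping;
TOWER-E1 is OPEN and XL (Bałaban-type RG at fixed femto size with one irregular UV layer — the layer's harmlessness is itself not in print); femto rung R2b1;
not infinite volume, not a gap, not Clay.
-/

set_option autoImplicit false

noncomputable section

open MeasureTheory Filter Topology Real
open scoped BigOperators

namespace Summit.QuantumFields.YangMills.Theorems.FemtoTransferGap.TwoLattice

open Summit.QuantumFields.YangMills.Theorems.FemtoTransferGap
open Summit.QuantumFields.YangMills.Theorems.FemtoTransferGap.TraceDoor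
open Summit.QuantumFields.YangMills.Theorems.FemtoTransferGap.TT (physTrace)

namespace Tower

/-! ## §1 E1 arithmetic (owner ym-beyond-p1 g24, `CoverageSketch.lean` 8e70bcfb3fd72b70, ported) -/

/-- **E1 landing**: for `M ≥ 2` and every `L ≥ M²` there are `k` and a base `b ∈ [M, M²)` with `b·M^{k+1} ≤ L < b·M^k·(M+1)` — one irregular layer of
block sides `M`/`M+1` maps `(ℤ/L)` onto `(ℤ/(b·M^k))`, which is then regularly `M`-blockable `k` times down to `b`. [folklore] -/
theorem exists_tower_landing {M : ℕ} (hM : 2 ≤ M) {L : ℕ} (hL : M ^ 2 ≤ L) :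
    ∃ k b : ℕ, M ≤ b ∧ b < M ^ 2 ∧ b * M ^ (k + 1) ≤ L ∧ L < b * M ^ k * (M + 1) := by
  -- ported from the owner's CoverageSketch.lean (ym-beyond-p1 g24), proof unchanged
  have hM1 : 1 < M := hM
  have hL0 : L ≠ 0 := by
    have : 0 < M ^ 2 := by positivity
    omega
  have h1 : M ^ Nat.log M L ≤ L := Nat.pow_log_le_self M hL0
  have h2 : L < M ^ (Nat.log M L + 1) := Nat.lt_pow_succ_log_self hM1 L
  have he2 : 2 ≤ Nat.log M L := Nat.le_log_of_pow_le hM1 hL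
  obtain ⟨k, hk⟩ : ∃ k, Nat.log M L = k + 2 := ⟨Nat.log M L - 2, by omega⟩
  rw [hk] at h1 h2
  have hpow : 0 < M ^ (k + 1) := by positivity
  have hL1 : M ≤ L / M ^ (k + 1) := by
    apply (Nat.le_div_iff_mul_le hpow).mpr
    calc M * M ^ (k + 1) = M ^ (k + 2) := by ring
      _ ≤ L := h1
  refine ⟨k, L / M ^ (k + 1), hL1, ?_, Nat.div_mul_le_self L (M ^ (k + 1)), ?_⟩
  · apply (Nat.div_lt_iff_lt_mul hpow).mpr
    calc L < M ^ (k + 2 + 1) := h2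
      _ = M ^ 2 * M ^ (k + 1) := by ring
  · have hstep : M ^ (k + 1) ≤ L / M ^ (k + 1) * M ^ k := by
      calc M ^ (k + 1) = M * M ^ k := by ring
        _ ≤ L / M ^ (k + 1) * M ^ k := Nat.mul_le_mul_right _ hL1
    calc L < L / M ^ (k + 1) * M ^ (k + 1) + M ^ (k + 1) := Nat.lt_div_mul_add hpow
      _ ≤ L / M ^ (k + 1) * M ^ (k + 1) + L / M ^ (k + 1) * M ^ k := by omega
      _ = L / M ^ (k + 1) * M ^ k * (M + 1) := by ring

/-! ## §2 ★ The crux from TOWER-E1 and S-BASE on the finite base range -/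

set_option maxHeartbeats 400000 in
/-- ★ **`TwistedTraceScaling` from the E1-shaped tower and the fixed-lattice law** (hypotheses: the TOWER-E1 text and VERBATIM the body of the registered
`Stmt.stub_fixedLatticeTraceLaw`; S-OSTL is the tree's closed `TraceDoor.oneSiteTraceLimit`).  Given `(s, ε)`: TOWER-E1 at `ε/3` gives `M` and a depth;
S-BASE at `ε/3` on each base `b < M²` gives thresholds `β1(b)`, of which a FINITE max `β⋆` is taken; the one-site limit at `ε/3` gives `B0`; deep enough in
the window every matched coarse coupling is `≥ 1/(4lam³) ≥ β⋆` and the one-site coupling is `≥ B0`; for `L ≥ M²`, `exists_tower_landing` picks `(k, b)`, the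
matched `β₁` on `b` exists (IVT), and the triangle `r(L) ~ r(b) ~ r_𝔥(s) ~ r(1, B)` closes. [cite: Luscher1983, §3] [cite: Balaban1989LargeFieldII, pp. 355–6] -/
theorem twistedTraceScaling_of_towerE1_of_base
    (hE1 : ∀ s : ℝ, 0 < s → ∀ ε : ℝ, 0 < ε → ∃ M : ℕ, 2 ≤ M ∧ ∃ lam0 : ℝ, 0 < lam0 ∧ ∀ lam : ℝ, 0 < lam → lam ≤ lam0 →
      ∀ (L : ℕ) [NeZero L], M ^ 2 ≤ L → ∀ β : ℝ, InFemtoWindow lam β L →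
        ∀ (b k : ℕ) [NeZero b], M ≤ b → b < M ^ 2 → b * M ^ (k + 1) ≤ L → L < b * M ^ k * (M + 1) →
          ∀ β₁ : ℝ, 1 ≤ β₁ → invRunningCoupling β₁ b = invRunningCoupling β L →
            |traceRatio L β (femtoSteps s β L) - traceRatio b β₁ (femtoSteps s β₁ b)| ≤ ε)
    (hBASE : ∀ (L1 : ℕ) [NeZero L1] (s : ℝ), 0 < s → ∀ ε : ℝ, 0 < ε → ∃ β1 : ℝ, ∀ β : ℝ, β1 ≤ β →
      |traceRatio L1 β (femtoSteps s β L1) - hTraceRatio s| ≤ ε) :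
    Summit.QuantumFields.YangMills.Theses.LuscherReduction.TwistedTraceScaling := by
  intro s hs ε hε
  have hε3 : 0 < ε / 3 := by positivity
  obtain ⟨M, hM, lamT, hlamT, hT⟩ := hE1 s hs (ε / 3) hε3
  -- S-BASE thresholds, uniformly over the finite base range (stated for every `b`, vacuous at `b = 0`)
  have hB : ∀ b : ℕ, ∃ β1 : ℝ, ∀ (hb : NeZero b) (β : ℝ), β1 ≤ β →
      |traceRatio b β (femtoSteps s β b) - hTraceRatio s| ≤ ε / 3 := by
    intro b
    by_cases hb0 : b = 0
    · exact ⟨0, fun hb => absurd hb0 hb.ne⟩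
    · haveI : NeZero b := ⟨hb0⟩
      obtain ⟨β1, h⟩ := hBASE b s hs (ε / 3) hε3
      exact ⟨β1, fun _ β hβ => h β hβ⟩
  choose β1 hβ1 using hB
  set βstar : ℝ := ∑ b ∈ Finset.range (M ^ 2), max (β1 b) 0 with hβstar
  have hβ1le : ∀ b : ℕ, b < M ^ 2 → β1 b ≤ βstar := fun b hb =>
    (le_max_left _ _).trans (Finset.single_le_sum (f := fun b => max (β1 b) 0) (fun i _ => le_max_right _ _)
      (Finset.mem_range.2 hb))
  -- one-site side
  obtain ⟨B0, hO⟩ := oneSiteTraceLimit s hs (ε / 3) hε3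
  set Mstar : ℝ := max (max βstar B0) 1 with hMstar
  have hM1 : 1 ≤ Mstar := le_max_right _ _
  have hMpos : 0 < Mstar := lt_of_lt_of_le one_pos hM1
  refine ⟨min (min lamT (1 / 2)) (min (1 / (4 * Mstar)) (s / 4)),
    lt_min (lt_min hlamT (by norm_num)) (lt_min (by positivity) (by positivity)), ?_⟩
  intro lam hlam hle
  have hleT : lam ≤ lamT := hle.trans ((min_le_left _ _).trans (min_le_left _ _))
  have hlehalf : lam ≤ 1 / 2 := hle.trans ((min_le_left _ _).trans (min_le_right _ _))
  have hleM : lam ≤ 1 / (4 * Mstar) := hle.trans ((min_le_right _ _).trans (min_le_left _ _))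
  have hles : lam ≤ s / 4 := hle.trans ((min_le_right _ _).trans (min_le_right _ _))
  have hle1 : lam ≤ 1 := by linarith
  haveI hM2 : NeZero (M ^ 2) := ⟨by positivity⟩
  refine ⟨M ^ 2, ?_⟩
  intro L _ hL β hW
  -- deep in the window: `β ≥ 1`, one-site coupling `≥ M⋆`, `T ≥ 2`, and `|T·λ_b(B) − s| ≤ λ_b(B)` at `B = oneSiteCoupling β L`
  have hl : 0 < luscherLambda β L := luscherLambda_pos_of_window hlam hW
  have hupos : 0 < luscherLambda β L / L := Base.unit_pos_of_window hlam hW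
  have hule : luscherLambda β L / L ≤ s / 2 := (Base.unit_le_of_window hlam hW).trans (by linarith)
  obtain ⟨hTu1, hTu2⟩ := Base.femtoSteps_mul_unit (L1 := L) hs.le hlam hW
  have hT2 : 2 ≤ femtoSteps s β L := by
    have h1' : (2 : ℝ) * (luscherLambda β L / L) ≤ (femtoSteps s β L : ℝ) * (luscherLambda β L / L) := by linarith
    have h2 : (2 : ℝ) ≤ (femtoSteps s β L : ℝ) := le_of_mul_le_mul_right h1' hupos
    exact_mod_cast h2
  have hBM : Mstar ≤ oneSiteCoupling β L := (le_of_lam_small hlam hle1 hMpos hleM).trans (oneSiteCoupling_ge_of_window hlam hW)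
  have hTsub : |(femtoSteps s β L : ℝ) * bareLambda (oneSiteCoupling β L) - s| ≤ bareLambda (oneSiteCoupling β L) := by
    rw [bareLambda_oneSiteCoupling hl, abs_le]
    constructor <;> linarith
  have hB0le : B0 ≤ oneSiteCoupling β L := ((le_max_right _ _).trans (le_max_left _ _)).trans hBM
  have hBone : 1 ≤ oneSiteCoupling β L := hM1.trans hBM
  -- E1 landing and the matched coarse coupling on the base
  obtain ⟨k, b, hMb, hbM2, hbL, hLb⟩ := exists_tower_landing hM hL
  haveI hb : NeZero b := ⟨by omega⟩
  obtain ⟨β₁, hβ₁1, hmatch⟩ :=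
    exists_matched b (v := invRunningCoupling β L) (one_le_invRunningCoupling_of_window hlam hlehalf hW)
  have hβ₁ge : β1 b ≤ β₁ :=
    ((hβ1le b hbM2).trans (((le_max_left _ _).trans (le_max_left _ _)).trans
      ((le_of_lam_small hlam hle1 hMpos hleM).trans (matched_ge hlam hW hβ₁1 hmatch))))
  have hTow := hT lam hlam hleT L hL β hW b k hMb hbM2 hbL hLb β₁ hβ₁1 hmatch
  have hBas := hβ1 b hb β₁ hβ₁ge
  have hOs := hO (oneSiteCoupling β L) hB0le (femtoSteps s β L) hTsub
  rw [← Base.traceRatio_eq_levelRatio 1 hBone hT2, abs_sub_comm] at hOs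
  show |traceRatio L β (femtoSteps s β L) - traceRatio 1 (oneSiteCoupling β L) (femtoSteps s β L)| ≤ ε
  set r : ℝ := traceRatio L β (femtoSteps s β L)
  set r₁ : ℝ := traceRatio b β₁ (femtoSteps s β₁ b)
  set o : ℝ := traceRatio 1 (oneSiteCoupling β L) (femtoSteps s β L)
  set h : ℝ := hTraceRatio s
  calc |r - o| = |(r - r₁) + (r₁ - h) + (h - o)| := by congr 1; ring
    _ ≤ |(r - r₁) + (r₁ - h)| + |h - o| := abs_add_le _ _
    _ ≤ ε := by linarith [abs_add_le (r - r₁) (r₁ - h), hTow, hBas, hOs]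

/-! ## §3 The reshaped text is weaker than the registered S-TOWER -/

/-- **S-TOWER ⇒ TOWER-E1**: the registered all-pairs text implies the E1-shaped one (bases `b ≥ M ≥ L0`, fine lattices `L ≥ b·M^{k+1} ≥ b`).  So
replacing S-TOWER by TOWER-E1 WEAKENS the stub while §2 keeps the crux closed — the honest block-spin target per ruling R2. [folklore] -/
theorem towerE1_of_tower
    (hTOWER : ∀ s : ℝ, 0 < s → ∀ ε : ℝ, 0 < ε → ∃ L0 : ℕ, ∃ lam0 : ℝ, 0 < lam0 ∧ ∀ lam : ℝ, 0 < lam → lam ≤ lam0 →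
      ∀ (L1 : ℕ) [NeZero L1], L0 ≤ L1 → ∀ (L : ℕ) [NeZero L], L1 ≤ L → ∀ β : ℝ, InFemtoWindow lam β L →
        ∀ β₁ : ℝ, 1 ≤ β₁ → invRunningCoupling β₁ L1 = invRunningCoupling β L →
          |traceRatio L β (femtoSteps s β L) - traceRatio L1 β₁ (femtoSteps s β₁ L1)| ≤ ε) :
    ∀ s : ℝ, 0 < s → ∀ ε : ℝ, 0 < ε → ∃ M : ℕ, 2 ≤ M ∧ ∃ lam0 : ℝ, 0 < lam0 ∧ ∀ lam : ℝ, 0 < lam → lam ≤ lam0 →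
      ∀ (L : ℕ) [NeZero L], M ^ 2 ≤ L → ∀ β : ℝ, InFemtoWindow lam β L →
        ∀ (b k : ℕ) [NeZero b], M ≤ b → b < M ^ 2 → b * M ^ (k + 1) ≤ L → L < b * M ^ k * (M + 1) →
          ∀ β₁ : ℝ, 1 ≤ β₁ → invRunningCoupling β₁ b = invRunningCoupling β L →
            |traceRatio L β (femtoSteps s β L) - traceRatio b β₁ (femtoSteps s β₁ b)| ≤ ε := by
  intro s hs ε hε
  obtain ⟨L0, lam0, hlam0, H⟩ := hTOWER s hs ε hε
  refine ⟨max L0 2, le_max_right _ _, lam0, hlam0, ?_⟩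
  intro lam hlam hle L _ _ β hW b k _ hMb _ hbL _ β₁ hβ₁ hmatch
  have hL0b : L0 ≤ b := (le_max_left _ _).trans hMb
  have hbL' : b ≤ L := le_trans (Nat.le_mul_of_pos_right _ (by positivity)) hbL
  exact H lam hlam hle b hL0b L hbL' β hW β₁ hβ₁ hmatch

/-! ## §4 The located XL target in RG-native currency: `LogRatioMatch` restricted to E1-reachable pairs -/

/-- ★ **`LogRatioMatch-E1 ⇒ TOWER-E1`** (owner's A3 typing, (W2·g26) NEXT): the RG-native log-closeness of the dyadic zero-flux trace ratios, RESTRICTED to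
E1-reachable pairs `(L, b)`, implies the E1-shaped tower — on `(0,1]` (`Tower.traceRatio_mem`) the exponential is 1-Lipschitz.  Hence
`LogRatioMatch-E1 ∧ S-BASE ⟹ TwistedTraceScaling` by `twistedTraceScaling_of_towerE1_of_base`.  THIS hypothesis text is the located open content A3 of
S-TOWER for strategy A: a Bałaban small-field/large-field flow from spacing `1/L` through ONE irregular layer (sides `M`/`M+1`, the E1 COVERAGE hypothesis, not in print)
and `k` regular `M`-layers to the base `b ∈ [M, M²)` at fixed femto size, delivering relative control of the last-scale blocked action against Wilson's at the
matched `β₁` in the combination `log Z(2T) − 2 log Z(T) = log m(2T) − 2 log m(T)` (no bulk term). [cite: Balaban1988Convergent] [cite: Balaban1989LargeFieldII, pp. 355–6]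
[cite: LuscherWeiszWolff1991, §2] -/
theorem towerE1_of_logRatioMatchE1
    (hLog : ∀ s : ℝ, 0 < s → ∀ ε : ℝ, 0 < ε → ∃ M : ℕ, 2 ≤ M ∧ ∃ lam0 : ℝ, 0 < lam0 ∧ ∀ lam : ℝ, 0 < lam → lam ≤ lam0 →
      ∀ (L : ℕ) [NeZero L], M ^ 2 ≤ L → ∀ β : ℝ, InFemtoWindow lam β L →
        ∀ (b k : ℕ) [NeZero b], M ≤ b → b < M ^ 2 → b * M ^ (k + 1) ≤ L → L < b * M ^ k * (M + 1) →
          ∀ β₁ : ℝ, 1 ≤ β₁ → invRunningCoupling β₁ b = invRunningCoupling β L →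
            |Real.log (traceRatio L β (femtoSteps s β L)) - Real.log (traceRatio b β₁ (femtoSteps s β₁ b))| ≤ ε) :
    ∀ s : ℝ, 0 < s → ∀ ε : ℝ, 0 < ε → ∃ M : ℕ, 2 ≤ M ∧ ∃ lam0 : ℝ, 0 < lam0 ∧ ∀ lam : ℝ, 0 < lam → lam ≤ lam0 →
      ∀ (L : ℕ) [NeZero L], M ^ 2 ≤ L → ∀ β : ℝ, InFemtoWindow lam β L →
        ∀ (b k : ℕ) [NeZero b], M ≤ b → b < M ^ 2 → b * M ^ (k + 1) ≤ L → L < b * M ^ k * (M + 1) →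
          ∀ β₁ : ℝ, 1 ≤ β₁ → invRunningCoupling β₁ b = invRunningCoupling β L →
            |traceRatio L β (femtoSteps s β L) - traceRatio b β₁ (femtoSteps s β₁ b)| ≤ ε := by
  intro s hs ε hε
  obtain ⟨M, hM, lam0, hlam0, H⟩ := hLog s hs ε hε
  refine ⟨M, hM, min lam0 (s / 4), lt_min hlam0 (by positivity), ?_⟩
  intro lam hlam hle L _ hL β hW b k _ hMb hbM2 hbL hLb β₁ hβ₁ hmatch
  have hle0 : lam ≤ lam0 := hle.trans (min_le_left _ _)
  have hles : lam ≤ s / 4 := hle.trans (min_le_right _ _)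
  have hW₁ : InFemtoWindow lam β₁ b := window_of_matched hW hβ₁ hmatch
  obtain ⟨hβ1, _, hT2⟩ := stmt_of_logRatioMatch.deepT hs hlam hles hW
  obtain ⟨hβ₁1, _, hT2₁⟩ := stmt_of_logRatioMatch.deepT hs hlam hles hW₁
  obtain ⟨hr, hr1⟩ := traceRatio_mem L hβ1 hT2
  obtain ⟨hr₁, hr₁1⟩ := traceRatio_mem b hβ₁1 hT2₁
  exact (Literature.Analysis.Complex.FarSet.abs_sub_le_abs_log_sub_log hr hr1 hr₁ hr₁1).trans
    (H lam hlam hle0 L hL β hW b k hMb hbM2 hbL hLb β₁ hβ₁ hmatch)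

/-- ★ **The crux from `LogRatioMatch-E1` and S-BASE** — the of-record composition for strategy A under ruling A4/R2 (E1 coverage BY NAME in the hypothesis).
[cite: Balaban1989LargeFieldII, pp. 355–6] [cite: Luscher1983, §3] -/
theorem twistedTraceScaling_of_logRatioMatchE1_of_base
    (hLog : ∀ s : ℝ, 0 < s → ∀ ε : ℝ, 0 < ε → ∃ M : ℕ, 2 ≤ M ∧ ∃ lam0 : ℝ, 0 < lam0 ∧ ∀ lam : ℝ, 0 < lam → lam ≤ lam0 →
      ∀ (L : ℕ) [NeZero L], M ^ 2 ≤ L → ∀ β : ℝ, InFemtoWindow lam β L →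
        ∀ (b k : ℕ) [NeZero b], M ≤ b → b < M ^ 2 → b * M ^ (k + 1) ≤ L → L < b * M ^ k * (M + 1) →
          ∀ β₁ : ℝ, 1 ≤ β₁ → invRunningCoupling β₁ b = invRunningCoupling β L →
            |Real.log (traceRatio L β (femtoSteps s β L)) - Real.log (traceRatio b β₁ (femtoSteps s β₁ b))| ≤ ε)
    (hBASE : ∀ (L1 : ℕ) [NeZero L1] (s : ℝ), 0 < s → ∀ ε : ℝ, 0 < ε → ∃ β1 : ℝ, ∀ β : ℝ, β1 ≤ β →
      |traceRatio L1 β (femtoSteps s β L1) - hTraceRatio s| ≤ ε) :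
    Summit.QuantumFields.YangMills.Theses.LuscherReduction.TwistedTraceScaling :=
  twistedTraceScaling_of_towerE1_of_base (towerE1_of_logRatioMatchE1 hLog) hBASE

end Tower

end Summit.QuantumFields.YangMills.Theorems.FemtoTransferGap.TwoLattice

end
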